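import Literature.IUT.LogVolume.Corollary22Thm110LegendreWitness
import Literature.IUT.LogVolume.PrincipalArithmeticDivisors
import Literature.NumberTheory.NumberFields.CyclotomicFieldFourPrimaryCongruence
import Literature.NumberTheory.DiophantineGeometry.GenEllProjLineExamples
import HarnessLib

/-!
# The fork at [IUTchIII] Corollary 3.12, L-DH level: ADMISSIBLE points ON the split-bad locus — I. The Gaussian
# witness family `λ_m = i·2^m/(1 + i·2^{m+1})` as points of the `λ`-line (`U_P`, degree, compact boundedness)

Proof-only file (D-0012; 0 definitions, no `Prop` fact) of the abc-iut cell (seat abc-iut-w5-d126). TAKES NO SIDE on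
[IUTchIII] Cor. 3.12 or [IUTchIV] Thm. 1.10; its content is classical arithmetic of the `λ`-line over `ℚ(i)`.
S. Mochizuki, *IUT IV* [Mochizuki2012], Cor. 2.2 (ii) proof pp. 45–46 ((P2), (P5), (P6)); S. Mochizuki, *Arithmetic
elliptic curves in general position* [MochizukiGenEll2010], Ex. 1.3 (ii) p. 5 (compactly bounded subsets); K. Ireland,
M. Rosen [IrelandRosen1982], Ch. 9 §7 p. 120 (`ℤ[i]`, complex conjugation, `N(a + bi) = a² + b²`).

WHY. The cell's R2 S-chain reads the (U)-line of the Cor. 3.12 fork on the SPLIT-BAD POINT LOCUS «every rational prime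
`p` carries `j(λ)`-pole mass `≤ 1/2` in `ℚ(λ)` away from `2l`» (abc-iut-s2-p4: `LDHSplitLocusDisplay.lean` p434756,
`LDHSplitLocusDisplayPoint.lean` p435674/p436687 — there the typed Corollary `Cor22.Cor312AtDatum` is a THEOREM and v4's
CONE binder `hreg` is BY ITSELF [IUTchIV] Thm. 1.10's display). Those files state IN PROSE that the locus contains
ADMISSIBLE `λ` (the binders of `Cor22.Thm110Legendre`: `P ∈ UP`, `AdmitsCore`, (P2), (P5), (P6)) of unbounded height.
This series (`…Point`, `…Poles`, `…Locus`, `LDHSplitBadWitness`) proves it in the kernel with the family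

  `λ_m := i·2^m / (1 + i·2^{m+1}) ∈ ℚ(i)`, `m : ℕ`, over any model `F` of `ℚ(i)` (`IsCyclotomicExtension {4} ℚ F`),
  written below with a primitive fourth root of unity `ζ ∈ 𝓞 F` (`ζ = i`).

THIS FILE (the point `P_m := (F, λ_m)`): `λ_m ≠ 0, 1`; `1 − λ_m = (1 + i2^m)/(1 + i2^{m+1})`; `ℚ(λ_m) = ℚ(i)` so
`P_m ∈ UP` (minimally presented) and `deg P_m = 2`; every complex embedding has `|φ(1 + i2^k)| = √(1 + 4^k)`, whence
`|φ(λ_m) − 1/2| = 1/(2|φ(1 + i2^{m+1})|) ≤ 1/4`: `P_m` lies in the standard compactly bounded subset `CBData.std ∅`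
(archimedean disc `|z − 1/2| ≤ 1/4`, empty nonarchimedean support). HONEST SCOPE: classical; nothing asserted about print.
[cite: MochizukiGenEll2010, Ex 1.3 (ii) p.5] [cite: IrelandRosen1982, Ch. 9 §7 p. 120]
[claim: Mochizuki2012, status: disputed] for every IUT locator quoted.
-/

noncomputable section

namespace Summit.ABC.IUTFork

namespace SplitBadWitness

open NumberField IsDedekindDomain Metric Finset
open Literature.IUT.LogVolume Literature.IUT.LogVolume.Cor22
open Literature.NumberTheory.DiophantineGeometry Literature.NumberTheory.DiophantineGeometry.GenEll
open Literature.NumberTheory.NumberFields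

variable {F : Type} [Field F] [NumberField F] {ζ : 𝓞 F}

/-! ## Algebra of `i`, `β_k := 1 + i·2^k` and `λ_m` in the field -/

omit [NumberField F] in
/-- `i² = −1` for (the field image of) a primitive fourth root of unity. [cite: IrelandRosen1982, Ch. 9 §7 p. 120] -/
theorem coe_sq (hζ : IsPrimitiveRoot ζ 4) : ((ζ : F)) ^ 2 = -1 := by
  have h : ζ ^ 2 = -1 := (hζ.pow (by norm_num) (by norm_num : 4 = 2 * 2)).eq_neg_one_of_two_right
  have := congrArg (fun x : 𝓞 F => (x : F)) h
  simpa using this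

/-- `i ≠ 0` in the field. [cite: IrelandRosen1982, Ch. 9 §7 p. 120] -/
theorem coe_ne_zero (hζ : IsPrimitiveRoot ζ 4) : (ζ : F) ≠ 0 := by
  intro h
  have := coe_sq hζ
  rw [h] at this
  norm_num at this

/-- `1 + i·2^k ≠ 0` (else `i = −2^{−k}` would be rational and `i² = 4^{−k} ≠ −1`). [cite: IrelandRosen1982, Ch. 9 §7 p. 120] -/
theorem one_add_mul_pow_ne_zero (hζ : IsPrimitiveRoot ζ 4) (k : ℕ) : (1 : F) + (ζ : F) * 2 ^ k ≠ 0 := by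
  intro h
  have h1 : (ζ : F) * 2 ^ k = -1 := by linear_combination h
  have h2 : ((ζ : F) * 2 ^ k) ^ 2 = 1 := by rw [h1]; norm_num
  have h3 : ((ζ : F) * 2 ^ k) ^ 2 = -(4 : F) ^ k := by
    rw [mul_pow, coe_sq hζ, ← pow_mul, show (2 : F) ^ (k * 2) = 4 ^ k by rw [mul_comm, pow_mul]; norm_num]
    ring
  rw [h3] at h2
  have h4 : ((4 ^ k + 1 : ℕ) : F) = 0 := by push_cast; linear_combination -h2
  exact (Nat.cast_ne_zero.mpr (Nat.succ_ne_zero _)) h4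

/-- `λ_m ≠ 0`. [cite: MochizukiGenEll2010, Thm 2.1 (ii) p.11] -/
theorem lam_ne_zero (hζ : IsPrimitiveRoot ζ 4) (m : ℕ) :
    (ζ : F) * 2 ^ m / (1 + (ζ : F) * 2 ^ (m + 1)) ≠ 0 :=
  div_ne_zero (mul_ne_zero (coe_ne_zero hζ) (pow_ne_zero _ two_ne_zero)) (one_add_mul_pow_ne_zero hζ (m + 1))

/-- `1 − λ_m = (1 + i·2^m)/(1 + i·2^{m+1})`. [cite: IrelandRosen1982, Ch. 9 §7 p. 120] -/
theorem one_sub_lam (hζ : IsPrimitiveRoot ζ 4) (m : ℕ) :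
    1 - (ζ : F) * 2 ^ m / (1 + (ζ : F) * 2 ^ (m + 1)) = (1 + (ζ : F) * 2 ^ m) / (1 + (ζ : F) * 2 ^ (m + 1)) := by
  have hβ := one_add_mul_pow_ne_zero hζ (m + 1)
  rw [eq_div_iff hβ, sub_mul, div_mul_cancel₀ _ hβ]
  ring

/-- `λ_m − 1/2 = −1/(2·(1 + i·2^{m+1}))`. [cite: IrelandRosen1982, Ch. 9 §7 p. 120] -/
theorem lam_sub_half (hζ : IsPrimitiveRoot ζ 4) (m : ℕ) :
    (ζ : F) * 2 ^ m / (1 + (ζ : F) * 2 ^ (m + 1)) - 2⁻¹ = -(2 * (1 + (ζ : F) * 2 ^ (m + 1)))⁻¹ := by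
  have hβ := one_add_mul_pow_ne_zero hζ (m + 1)
  field_simp
  ring

/-- `λ_m ≠ 1`. [cite: MochizukiGenEll2010, Thm 2.1 (ii) p.11] -/
theorem lam_ne_one (hζ : IsPrimitiveRoot ζ 4) (m : ℕ) :
    (ζ : F) * 2 ^ m / (1 + (ζ : F) * 2 ^ (m + 1)) ≠ 1 := by
  intro h
  have h1 := one_sub_lam hζ m
  rw [h, sub_self, eq_comm, div_eq_zero_iff] at h1
  rcases h1 with h1 | h1
  · exact one_add_mul_pow_ne_zero hζ m h1
  · exact one_add_mul_pow_ne_zero hζ (m + 1) h1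

/-- `i = λ_m / (2^m·(1 − 2λ_m))` with a non-zero denominator: `i ∈ ℚ(λ_m)`. [cite: IrelandRosen1982, Ch. 9 §7 p. 120] -/
theorem coe_eq_lam_div (hζ : IsPrimitiveRoot ζ 4) (m : ℕ) :
    (2 : F) ^ m * (1 - 2 * ((ζ : F) * 2 ^ m / (1 + (ζ : F) * 2 ^ (m + 1)))) ≠ 0 ∧
      (ζ : F) = ((ζ : F) * 2 ^ m / (1 + (ζ : F) * 2 ^ (m + 1))) /
        (2 ^ m * (1 - 2 * ((ζ : F) * 2 ^ m / (1 + (ζ : F) * 2 ^ (m + 1))))) := by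
  have hβ := one_add_mul_pow_ne_zero hζ (m + 1)
  have hkey : (2 : F) ^ m * (1 - 2 * ((ζ : F) * 2 ^ m / (1 + (ζ : F) * 2 ^ (m + 1)))) =
      2 ^ m / (1 + (ζ : F) * 2 ^ (m + 1)) := by
    field_simp; ring
  have hne : (2 : F) ^ m * (1 - 2 * ((ζ : F) * 2 ^ m / (1 + (ζ : F) * 2 ^ (m + 1)))) ≠ 0 := by
    rw [hkey]; exact div_ne_zero (pow_ne_zero _ two_ne_zero) hβ
  refine ⟨hne, ?_⟩
  rw [hkey]
  field_simp

/-! ## The point `P_m := (F, λ_m)` is minimally presented: `ℚ(λ_m) = ℚ(i) = F` -/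

/-- **`P_m ∈ UP`**: `λ_m ∈ U_X` (`≠ 0, 1`) and `ℚ(λ_m) = F` (`i ∈ ℚ(λ_m)` and `F = ℚ(i)`).
[cite: MochizukiGenEll2010, Def 1.5 (i) p.8] -/
theorem mem_UP [IsCyclotomicExtension {4} ℚ F] (hζ : IsPrimitiveRoot ζ 4) (m : ℕ) :
    (⟨F, (ζ : F) * 2 ^ m / (1 + (ζ : F) * 2 ^ (m + 1))⟩ : NFPoint) ∈ UP := by
  refine ⟨⟨lam_ne_zero hζ m, lam_ne_one hζ m⟩, ?_⟩
  change IntermediateField.adjoin ℚ ({(ζ : F) * 2 ^ m / (1 + (ζ : F) * 2 ^ (m + 1))} : Set F) = ⊤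
  set x := (ζ : F) * 2 ^ m / (1 + (ζ : F) * 2 ^ (m + 1)) with hx
  set K' := IntermediateField.adjoin ℚ ({x} : Set F)
  have hlam : x ∈ K' := IntermediateField.mem_adjoin_simple_self ℚ x
  have hζK : (ζ : F) ∈ K' := by
    obtain ⟨-, h⟩ := coe_eq_lam_div hζ m
    rw [h]
    refine div_mem hlam (mul_mem (pow_mem ?_ m) (sub_mem (one_mem K') (mul_mem ?_ hlam)))
    · exact_mod_cast (natCast_mem K' 2)
    · exact_mod_cast (natCast_mem K' 2)
  have hζ' : IsPrimitiveRoot (ζ : F) 4 := hζ.map_of_injective (FaithfulSMul.algebraMap_injective (𝓞 F) F)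
  rw [eq_top_iff]
  have htop : Algebra.adjoin ℚ ({(ζ : F)} : Set F) = ⊤ :=
    IsCyclotomicExtension.adjoin_primitive_root_eq_top (n := 4) (A := ℚ) (B := F) hζ'
  intro y _
  have hy : y ∈ Algebra.adjoin ℚ ({(ζ : F)} : Set F) := by rw [htop]; exact Algebra.mem_top
  have hle : Algebra.adjoin ℚ ({(ζ : F)} : Set F) ≤ K'.toSubalgebra :=
    Algebra.adjoin_le (Set.singleton_subset_iff.mpr hζK)
  exact hle hy

/-- `[ℚ(i) : ℚ] = 2`, i.e. `deg P_m = 2`. [cite: IrelandRosen1982, Ch. 9 §7 p. 120] -/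
theorem finrank_eq_two (F : Type) [Field F] [NumberField F] [IsCyclotomicExtension {4} ℚ F] :
    Module.finrank ℚ F = 2 := by
  rw [IsCyclotomicExtension.finrank (n := 4) F (Polynomial.cyclotomic.irreducible_rat (by norm_num))]
  show Nat.totient (2 ^ 2) = 2
  rw [Nat.totient_prime_pow Nat.prime_two two_pos]
  norm_num

/-! ## All conjugates of `λ_m` lie in the disc `|z − 1/2| ≤ 1/4` -/

/-- Every embedding `F → ℂ` sends `i` to `±I`. [cite: IrelandRosen1982, Ch. 9 §7 p. 120] -/
theorem embedding_coe (hζ : IsPrimitiveRoot ζ 4) (φ : F →+* ℂ) : φ (ζ : F) = Complex.I ∨ φ (ζ : F) = -Complex.I := by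
  have hφ : φ (ζ : F) ^ 2 = Complex.I ^ 2 := by rw [← map_pow, coe_sq hζ, map_neg, map_one, Complex.I_sq]
  exact sq_eq_sq_iff_eq_or_eq_neg.1 hφ

/-- `|φ(1 + i·2^k)| = √(1 + 4^k)` for every embedding `φ : F → ℂ`. [cite: IrelandRosen1982, Ch. 9 §7 p. 120] -/
theorem norm_embedding_one_add (hζ : IsPrimitiveRoot ζ 4) (φ : F →+* ℂ) (k : ℕ) :
    ‖φ (1 + (ζ : F) * 2 ^ k)‖ = Real.sqrt (1 + 4 ^ k) := by
  have hsq : Complex.normSq (φ (1 + (ζ : F) * 2 ^ k)) = 1 + 4 ^ k := by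
    rw [map_add, map_one, map_mul, map_pow, map_ofNat]
    have h4 : (4 : ℝ) ^ k = (2 ^ k) ^ 2 := by rw [← pow_mul, mul_comm, pow_mul]; norm_num
    have hc : ((2 : ℂ) ^ k) = (((2 : ℝ) ^ k : ℝ) : ℂ) := by push_cast; rfl
    rw [hc]
    rcases embedding_coe hζ φ with h | h
    · rw [h, show (1 : ℂ) + Complex.I * (((2 : ℝ) ^ k : ℝ) : ℂ) = ((1 : ℝ) : ℂ) + (((2 : ℝ) ^ k : ℝ) : ℂ) * Complex.I by
        push_cast; ring, Complex.normSq_add_mul_I, h4]; ring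
    · rw [h, show (1 : ℂ) + -Complex.I * (((2 : ℝ) ^ k : ℝ) : ℂ) = ((1 : ℝ) : ℂ) + ((-(2 : ℝ) ^ k : ℝ) : ℂ) * Complex.I by
        push_cast; ring, Complex.normSq_add_mul_I, h4]; ring
  rw [← hsq, Complex.normSq_eq_norm_sq, Real.sqrt_sq (norm_nonneg _)]

/-- `|φ(1 + i·2^{m+1})| ≥ 2`. [cite: IrelandRosen1982, Ch. 9 §7 p. 120] -/
theorem two_le_norm_embedding (hζ : IsPrimitiveRoot ζ 4) (φ : F →+* ℂ) (m : ℕ) :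
    2 ≤ ‖φ (1 + (ζ : F) * 2 ^ (m + 1))‖ := by
  rw [norm_embedding_one_add hζ]
  have h4 : (4 : ℝ) ≤ 1 + 4 ^ (m + 1) := by
    have : (4 : ℝ) ≤ 4 ^ (m + 1) := by
      calc (4 : ℝ) = 4 ^ 1 := (pow_one _).symm
        _ ≤ 4 ^ (m + 1) := pow_le_pow_right₀ (by norm_num) (by omega)
    linarith
  calc (2 : ℝ) = Real.sqrt 4 := by rw [show (4 : ℝ) = 2 ^ 2 by norm_num, Real.sqrt_sq (by norm_num)]
    _ ≤ Real.sqrt (1 + 4 ^ (m + 1)) := Real.sqrt_le_sqrt h4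

/-- `|φ(λ_m) − 1/2| ≤ 1/4` for every embedding `φ : F → ℂ`. [cite: MochizukiGenEll2010, Ex 1.3 (ii) p.5] -/
theorem dist_embedding_lam_le (hζ : IsPrimitiveRoot ζ 4) (φ : F →+* ℂ) (m : ℕ) :
    dist (φ ((ζ : F) * 2 ^ m / (1 + (ζ : F) * 2 ^ (m + 1)))) 2⁻¹ ≤ 4⁻¹ := by
  rw [dist_eq_norm]
  have h : φ ((ζ : F) * 2 ^ m / (1 + (ζ : F) * 2 ^ (m + 1))) - 2⁻¹ =
      φ ((ζ : F) * 2 ^ m / (1 + (ζ : F) * 2 ^ (m + 1)) - 2⁻¹) := by rw [map_sub, map_inv₀, map_ofNat]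
  rw [h, lam_sub_half hζ, map_neg, map_inv₀, map_mul φ (2 : F) (1 + (ζ : F) * 2 ^ (m + 1)), map_ofNat, norm_neg,
    norm_inv, norm_mul, Complex.norm_ofNat]
  have h2 := two_le_norm_embedding hζ φ m
  have hpos : (0 : ℝ) < 2 * ‖φ (1 + (ζ : F) * 2 ^ (m + 1))‖ := by positivity
  rw [inv_le_comm₀ hpos (by norm_num), inv_inv]
  linarith

/-- **`P_m ∈ K_V` for `K_V = CBData.std ∅`** (archimedean disc `|z − 1/2| ≤ 1/4`, empty nonarchimedean support).
[cite: MochizukiGenEll2010, Ex 1.3 (ii) p.5] -/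
theorem mem_std_empty (hζ : IsPrimitiveRoot ζ 4) (m : ℕ) :
    (⟨F, (ζ : F) * 2 ^ m / (1 + (ζ : F) * 2 ^ (m + 1))⟩ : NFPoint) ∈ (CBData.std ∅ (by simp)).toSet := by
  refine ⟨fun τ => ?_, fun p hp => absurd hp (Finset.notMem_empty p)⟩
  change τ ((ζ : F) * 2 ^ m / (1 + (ζ : F) * 2 ^ (m + 1))) ∈ CBData.stdArc
  rw [CBData.stdArc, mem_closedBall]
  exact dist_embedding_lam_le hζ τ m

/-- At every archimedean place `w` of `F`: `|1 + i·2^k|_w = √(1 + 4^k)`. [cite: IrelandRosen1982, Ch. 9 §7 p. 120] -/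
theorem infinitePlace_one_add (hζ : IsPrimitiveRoot ζ 4) (w : InfinitePlace F) (k : ℕ) :
    w (1 + (ζ : F) * 2 ^ k) = Real.sqrt (1 + 4 ^ k) := by
  rw [← InfinitePlace.norm_embedding_eq w]
  exact norm_embedding_one_add hζ w.embedding k

/-- **Product formula at `β_m = 1 + i·2^{m+1}`**: `Σ_V ord_V(β_m)·log N(V) = log(1 + 4^{m+1})` (sum over the finitely
many `V` with `ord_V(β_m) ≠ 0`; one complex place, `[ℂ:ℝ] = 2`, `|β_m| = √(1 + 4^{m+1})`). [cite: MochizukiGenEll2010, §1 p.4] -/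
theorem sum_ord_mul_logNorm_one_add [IsCyclotomicExtension {4} ℚ F] (hζ : IsPrimitiveRoot ζ 4) (m : ℕ) :
    ∑ V ∈ (finite_setOf_ord_ne_zero F (1 + (ζ : F) * 2 ^ (m + 1))).toFinset,
        (ord F V (1 + (ζ : F) * 2 ^ (m + 1)) : ℝ) * logNorm F V = Real.log (1 + 4 ^ (m + 1)) := by
  rw [sum_ord_mul_logNorm_eq_sum_mult_log (one_add_mul_pow_ne_zero hζ (m + 1)) (by simp)]
  simp_rw [infinitePlace_one_add hζ _ (m + 1)]
  rw [← Finset.sum_mul, ← Nat.cast_sum, InfinitePlace.sum_mult_eq, finrank_eq_two F,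
    Real.log_sqrt (by positivity)]
  push_cast
  ring

end SplitBadWitness

end Summit.ABC.IUTFork

end
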